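/-
Copyright: the b2b-balaban T⁴-continuum CRUX team, row NE7b, leaf prover `t4-ne7b-formalise-leaf-01` (gen 80), on the OWNER lineage
`t4-ne7b-p1` (gen 106)'s `CompactFibreCarrier` and the NE7b refuter (gen 69)'s located exit σ-ne7bref-g69-1 (a). Project licence.
-/
import Summits.QuantumFields.BalabanUV.T4Continuum.Spine.NE7b.StabilityWindowSandwich
import Mathlib.MeasureTheory.Integral.Prod
import Mathlib.MeasureTheory.Group.Integral

/-!
# THE FIBREWISE-RELATIVE COMPACT SANDWICH: positivity RELATIVE TO THE FIBRE MINIMUM `m(y)` on the numerator, a denominator MASS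
# letter `γ·e^{−(m(y)+i₀)} ≤ ∫ G·e^{−I(·,y)} dκ` — the interface energy `m(y)` CANCELS between numerator and denominator; the price is
# `e^{i₀}·(∫F dκ ∕ γ)`: a RELATIVE excess on a small centred window plus a volume letter, never a sup of the interaction
# (row NE7b, node U5c; model level; the refuter's κ-ne7bref-g69-1 → σ-ne7bref-g69-1 (a))

Cell `pub-balaban`, sub-cell `t4`, spine estimate NE7b (`T4WeightBudget.RelWeightBound` — the cell's OWN estimate, NOT PRINTED in
[Bałaban 1983–89], NOT PROVED).  Crux-route MODEL work under `Spine/NE7b/`; no `T4Continuum/Support` leaf, no `def`, no `Prop` minted,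
nothing of Bałaban's named as a hypothesis or asserted; 0 `sorry`.

WHY.  The OWNER's `…NE7b.CompactFibreCarrier.compactFibre_moment_le` (positivity alone on a compact near fibre `(K, κ)`, far space
`(Y, μ)`) carries the ABSOLUTE letters `hIpos : 0 ≤ I` on the numerator's support and `hIsmall : I ≤ i⁺` on the denominator's window.
The refuter located (PRICING-NE7b v75 F410, κ-ne7bref-g69-1) that `hIsmall` is a POINTWISE SUP of the whole core–collar interaction
over the product window: for plaquettes straddling the pinned region and its collar it is of the size of the extracted `p₀²` per
plaquette and kills the bound for the instance, while print cancels exactly this term — the windowed denominator is expanded around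
the BOUNDARY-DATA MINIMISER `U₀(y)` of the action at fixed far field `y` and only the volume of a `g_k`-neighbourhood and a positive
definite fluctuation form remain ([Balaban1989LargeFieldII] p. 356 «the term from the denominator is dangerous», (1.2)–(1.6), p. 357
«This quadratic form is positive definite»).  The refuter's exit σ-ne7bref-g69-1 (a), typed here as a kernel theorem in the OWNER's
currency: replace the two absolute letters by

* `hnum : F x ≠ 0 → w y ≠ 0 → m y ≤ I (x, y)` — positivity RELATIVE to a fibrewise level `m(y)` (e.g. the fibre minimum; free), and
* `hden : w y ≠ 0 → γ·e^{−(m y + i₀)} ≤ ∫ G·e^{−I(·,y)} dκ` — a MASS letter for the denominator's fibre integral.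

Then **`∫ F·w·e^{−I} d(κ⊗μ) ≤ e^{i₀}·(∫F dκ ∕ γ)·∫ G·w·e^{−I} d(κ⊗μ)`** (`relFibre_moment_le`): the level `m(y)` — the interface energy,
however large — disappears.  The mass letter is SUPPLIED (`hden_of_window`) by any measurable sub-window `S_y ⊆ {G ≥ 1}` of mass
`κ(S_y) ≥ γ` on which `I(·, y) ≤ m(y) + i₀` (a RELATIVE excess on a window of the consumer's radius — e.g. second order in the
radius at a minimiser), and on a GROUP fibre with a LEFT-INVARIANT `κ` (Haar) the centred window `S_y = U₀(y)·W` has mass `κ(W)`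
whatever the centre (`real_centredWindow`), so `γ = κ(W)` is `y`-UNIFORM: **`relFibre_moment_le_of_centredWindow`** with price
`e^{i₀}·(∫F dκ ∕ κ(W))`, i.e. `i₀ +` (the LOG OF THE VOLUME RATIO), the per-degree-of-freedom letter of `…CompactFibreCarrier` §2 and of
pub-balaban-gaps ne6's `…CompactFibreWindowSU2` ∕ `…SUN` (which value `−log κ(W)` for SU(2) ∕ SU(N) product windows).  The level
is unsigned: a large-field FLOOR `a` on the numerator's support (`m₀(y) + a ≤ I` where `F ≠ 0`) rides in `m(y) := m₀(y) + a` and turns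
the excess into `i₀ − a` (the refuter's shift β-ne7bref-g69-1); the centre `U₀ : Y → K` may depend on the INTEGRATED far variable (the
refuter's case (β) of ρ-ne7bref-g69-2 — with `Y` trivial or the centre constant it is case (α), which the OWNER's file hosts by the
shift alone).  The OWNER's absolute letters are the special case `m ≡ 0`, `i₀ = 0`, `γ = e^{−i⁺}·∫G dκ` (`hden_of_absolute`).  Carrier
form for the road's `LocCondStability` junctions: `relCarrier_le` ∕ `relCarrier_le_of_centredWindow` (`0 ≤ M ≤ e^{i₀ + b_vol}` per
background, with the volume letter `∫F dκ ∕ γ ≤ e^{b_vol}` displayed; `hfrac_of_subunit` gives `b_vol = −log κ(W)` when `∫F dκ ≤ 1`).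

WHAT IS PROVED ([folklore]; the OWNER's pointwise letters `mul_exp_neg_le_of_stability` ∕ `le_mul_exp_neg_of_small`
(`…StabilityWindowSandwich`), Fubini `integral_prod_symm` ∕ `Integrable.integral_prod_right`, `integral_mono_of_nonneg`,
`integral_indicator_const`, left invariance `measure_preimage_mul` ∕ `integral_mul_left_eq_self`): `fibre_moment_le` (one fibre), **`relFibre_moment_le`**,
`relFibre_moment_le_exp`, `hden_of_absolute`, **`hden_of_window`**, `real_centredWindow`, `measurableSet_centredWindow`,
**`relFibre_moment_le_of_centredWindow`**, `relCarrier_nonneg`, `relCarrier_le`, **`relCarrier_le_of_centredWindow`**, `hfrac_of_subunit`;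
and the PROFILE forms (the excess INTEGRATED instead of bounded — [Balaban1989LargeFieldII] (1.2)'s «`log σ₀`» shape): `hden_of_profile`,
`setIntegral_centredWindow` (`integral_mul_left_eq_self`), **`relFibre_moment_le_of_centredProfile`** (price `∫F dκ ∕ ∫_W e^{−q} dκ`, no sup).

NOT HERE (honest): that Bałaban's 𝐑-quotient [Balaban1989LargeFieldII] (1.1) IS of this form — which factors are `F`, `G`, `w`, that
the denominator's windows `δ_{G₀}`, `χ` CONTAIN a `U₀(y)`-centred window (`hGwin`), the values of `i₀` (second-order excess of the
action over its fibre minimum on a window of radius `∼ g_k`) and of `−log κ(W)` (the «`−½d(𝔤) log g_k⁻² + log σ₀`» per point of (1.2))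
— all (A3) ∕ (A1c) readings, NC-NE7b-α UNRULED; the minimiser's existence and regularity ((1.3), [Balaban1989LargeFieldII] refs. to the
variational papers); anything of Bałaban's.  BY-NAME EFFECT ON THE WALL: NONE.  NE7b NOT PRINTED ∕ NOT PROVED; spine PROVED 0∕9; rung
(B)+1 on a FINITE torus — NOT infinite volume, NOT the mass gap, NOT Clay.
HONEST DEPENDENCY: continuum YM on T⁴ ⇐ BetaPertH ∧ nine spine estimates (0/9 proved); BetaPertH ⇐ (D1) ∧ (D4) ∧ CAP+tail;
G-an2-4 gates asym, D1 and NE2/3/4.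
-/

set_option autoImplicit false

open MeasureTheory Real
open Summit.QuantumFields.BalabanUV.T4Continuum.NE7b.StabilityWindowSandwich

namespace Summit.QuantumFields.BalabanUV.T4Continuum.NE7b.CompactFibreRelative

/-! ## §1 The fibrewise-relative sandwich: the level `m(y)` cancels between numerator and denominator -/

section Relative

variable {K Y : Type*} [MeasurableSpace K] [MeasurableSpace Y] (κ : Measure K) (μ : Measure Y)

/-- **ONE FIBRE.**  Near fibre `(K, κ)`; numerator factor `F ≥ 0` integrable, a far weight VALUE `a ≥ 0`, interaction `J` on the fibre,
a level `m` with `m ≤ J` wherever `F ≠ 0` (when `a ≠ 0`), and the MASS letter `γ·e^{−(m+i₀)} ≤ ∫ G·e^{−J} dκ` (when `a ≠ 0`), `γ > 0`.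
Then `∫ F·a·e^{−J} dκ ≤ e^{i₀}·(∫F dκ ∕ γ)·∫ G·a·e^{−J} dκ` — the level `m` is gone. [folklore] -/
theorem fibre_moment_le (F G J : K → ℝ) {a m i₀ γ : ℝ} (hF0 : ∀ x, 0 ≤ F x) (ha : 0 ≤ a) (hγ : 0 < γ)
    (hnum : a ≠ 0 → ∀ x, F x ≠ 0 → m ≤ J x)
    (hden : a ≠ 0 → γ * exp (-(m + i₀)) ≤ ∫ x, G x * exp (-J x) ∂κ)
    (hF : Integrable F κ) :
    ∫ x, F x * a * exp (-J x) ∂κ ≤ (exp i₀ * ((∫ x, F x ∂κ) / γ)) * ∫ x, G x * a * exp (-J x) ∂κ := by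
  by_cases ha0 : a = 0
  · simp [ha0]
  -- numerator: STABILITY relative to the level, `F·a·e^{−J} ≤ e^{−m}·(F·a)` (the OWNER's pointwise letter)
  have h1 : ∫ x, F x * a * exp (-J x) ∂κ ≤ ∫ x, exp (-m) * (F x * a) ∂κ :=
    integral_mono_of_nonneg (ae_of_all κ fun x => mul_nonneg (mul_nonneg (hF0 x) ha) (exp_pos _).le)
      ((hF.mul_const a).const_mul _) (ae_of_all κ fun x => mul_exp_neg_le_of_stability (mul_nonneg (hF0 x) ha) fun hne => by
        rw [neg_neg]; exact hnum ha0 x (left_ne_zero_of_mul hne))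
  have h2 : ∫ x, exp (-m) * (F x * a) ∂κ = exp (-m) * ((∫ x, F x ∂κ) * a) := by
    rw [integral_const_mul, integral_mul_const]
  -- denominator: `e^{−m} ≤ e^{i₀}∕γ · ∫ G·e^{−J}`
  have h3 : exp (-m) ≤ exp i₀ / γ * ∫ x, G x * exp (-J x) ∂κ := by
    have hd : exp (-(m + i₀)) ≤ (∫ x, G x * exp (-J x) ∂κ) / γ := by
      rw [le_div_iff₀ hγ, mul_comm]; exact hden ha0
    calc exp (-m) = exp i₀ * exp (-(m + i₀)) := by rw [← exp_add]; congr 1; ring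
      _ ≤ exp i₀ * ((∫ x, G x * exp (-J x) ∂κ) / γ) := mul_le_mul_of_nonneg_left hd (exp_pos _).le
      _ = exp i₀ / γ * ∫ x, G x * exp (-J x) ∂κ := by ring
  have h4 : ∫ x, G x * a * exp (-J x) ∂κ = a * ∫ x, G x * exp (-J x) ∂κ := by
    rw [← integral_const_mul]; congr 1; ext x; ring
  calc ∫ x, F x * a * exp (-J x) ∂κ ≤ exp (-m) * ((∫ x, F x ∂κ) * a) := h1.trans_eq h2
    _ ≤ (exp i₀ / γ * ∫ x, G x * exp (-J x) ∂κ) * ((∫ x, F x ∂κ) * a) :=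
        mul_le_mul_of_nonneg_right h3 (mul_nonneg (integral_nonneg hF0) ha)
    _ = (exp i₀ * ((∫ x, F x ∂κ) / γ)) * ∫ x, G x * a * exp (-J x) ∂κ := by rw [h4]; ring

variable [SFinite κ] [SFinite μ]

/-- **THE FIBREWISE-RELATIVE COMPACT SANDWICH** (the refuter's σ-ne7bref-g69-1 (a), in the letters of
`…CompactFibreCarrier.compactFibre_moment_le`).  Near fibre `(K, κ)`, far space `(Y, μ)` (both s-finite); numerator near factor `F ≥ 0`
integrable on the fibre, denominator window `G`, far weight `w ≥ 0`, interaction `I` on `K × Y`, a fibrewise LEVEL `m : Y → ℝ` with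
`hnum : m y ≤ I (x, y)` wherever `F x ≠ 0 ∧ w y ≠ 0` (positivity RELATIVE to the level — for the fibre minimum this is free), and the
denominator's MASS letter `hden : γ·e^{−(m y + i₀)} ≤ ∫ G·e^{−I(·,y)} dκ` wherever `w y ≠ 0`, `γ > 0`; integrability of the two product
integrands displayed.  Then `∫ F(x)w(y)e^{−I} d(κ⊗μ) ≤ e^{i₀}·(∫F dκ ∕ γ)·∫ G(x)w(y)e^{−I} d(κ⊗μ)`: the level — the interface energy —
CANCELS; the price is the relative excess `i₀` and the volume letter `∫F dκ ∕ γ`, never a sup of `I`. [folklore] -/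
theorem relFibre_moment_le (F G : K → ℝ) (w : Y → ℝ) (I : K × Y → ℝ) (m : Y → ℝ) {i₀ γ : ℝ}
    (hF0 : ∀ x, 0 ≤ F x) (hw0 : ∀ y, 0 ≤ w y) (hγ : 0 < γ)
    (hnum : ∀ x y, F x ≠ 0 → w y ≠ 0 → m y ≤ I (x, y))
    (hden : ∀ y, w y ≠ 0 → γ * exp (-(m y + i₀)) ≤ ∫ x, G x * exp (-I (x, y)) ∂κ)
    (hF : Integrable F κ)
    (hA' : Integrable (fun z : K × Y => F z.1 * w z.2 * exp (-I z)) (κ.prod μ))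
    (hB' : Integrable (fun z : K × Y => G z.1 * w z.2 * exp (-I z)) (κ.prod μ)) :
    ∫ z, F z.1 * w z.2 * exp (-I z) ∂(κ.prod μ) ≤
      (exp i₀ * ((∫ x, F x ∂κ) / γ)) * ∫ z, G z.1 * w z.2 * exp (-I z) ∂(κ.prod μ) := by
  have fib : ∀ y, ∫ x, F x * w y * exp (-I (x, y)) ∂κ ≤
      (exp i₀ * ((∫ x, F x ∂κ) / γ)) * ∫ x, G x * w y * exp (-I (x, y)) ∂κ := fun y =>
    fibre_moment_le κ F G (fun x => I (x, y)) hF0 (hw0 y) hγ (fun hy x hx => hnum x y hx hy) (fun hy => hden y hy) hF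
  rw [integral_prod_symm _ hA', integral_prod_symm _ hB', ← integral_const_mul]
  exact integral_mono_of_nonneg
    (ae_of_all μ fun y => integral_nonneg fun x => mul_nonneg (mul_nonneg (hF0 x) (hw0 y)) (exp_pos _).le)
    (hB'.integral_prod_right.const_mul _) (ae_of_all μ fib)

/-- The same with the price in the exponent: `e^{i₀ + log(∫F dκ ∕ γ)}` when `∫F dκ > 0`. [folklore] -/
theorem relFibre_moment_le_exp (F G : K → ℝ) (w : Y → ℝ) (I : K × Y → ℝ) (m : Y → ℝ) {i₀ γ : ℝ}
    (hF0 : ∀ x, 0 ≤ F x) (hw0 : ∀ y, 0 ≤ w y) (hγ : 0 < γ)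
    (hnum : ∀ x y, F x ≠ 0 → w y ≠ 0 → m y ≤ I (x, y))
    (hden : ∀ y, w y ≠ 0 → γ * exp (-(m y + i₀)) ≤ ∫ x, G x * exp (-I (x, y)) ∂κ)
    (hFpos : 0 < ∫ x, F x ∂κ) (hF : Integrable F κ)
    (hA' : Integrable (fun z : K × Y => F z.1 * w z.2 * exp (-I z)) (κ.prod μ))
    (hB' : Integrable (fun z : K × Y => G z.1 * w z.2 * exp (-I z)) (κ.prod μ)) :
    ∫ z, F z.1 * w z.2 * exp (-I z) ∂(κ.prod μ) ≤
      exp (i₀ + Real.log ((∫ x, F x ∂κ) / γ)) * ∫ z, G z.1 * w z.2 * exp (-I z) ∂(κ.prod μ) := by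
  rw [exp_add, exp_log (div_pos hFpos hγ)]
  exact relFibre_moment_le κ μ F G w I m hF0 hw0 hγ hnum hden hF hA' hB'

omit [SFinite κ] in
/-- **THE OWNER's ABSOLUTE LETTERS ARE THE CASE `m ≡ 0`.**  On one fibre: `G ≥ 0` and `J ≤ i⁺` wherever `G ≠ 0` (the absolute
smallness letter of `…CompactFibreCarrier`; `G·e^{−J}` integrable) give the mass letter with level `0`, excess `0` and
`γ = e^{−i⁺}·∫G dκ`: `e^{−i⁺}·∫G dκ ≤ ∫ G·e^{−J} dκ`. [folklore] -/
theorem hden_of_absolute (G J : K → ℝ) {ip : ℝ} (hG0 : ∀ x, 0 ≤ G x) (hJ : ∀ x, G x ≠ 0 → J x ≤ ip)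
    (hGJ : Integrable (fun x => G x * exp (-J x)) κ) :
    exp (-ip) * ∫ x, G x ∂κ ≤ ∫ x, G x * exp (-J x) ∂κ := by
  rw [← integral_const_mul]
  refine integral_mono_of_nonneg (ae_of_all κ fun x => mul_nonneg (exp_pos _).le (hG0 x)) hGJ (ae_of_all κ fun x => ?_)
  -- the OWNER's pointwise SMALLNESS letter `G ≤ e^{i⁺}·(G·e^{−J})`, multiplied by `e^{−i⁺}`
  have h := mul_le_mul_of_nonneg_left (le_mul_exp_neg_of_small (hG0 x) (hJ x)) (exp_pos (-ip)).le
  rwa [← mul_assoc, ← exp_add, neg_add_cancel, exp_zero, one_mul] at h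

omit [SFinite κ] in
/-- **THE MASS LETTER FROM A SUB-WINDOW** (one fibre).  If the denominator factor `G ≥ 0` dominates the indicator of a measurable set
`S` (`1 ≤ G` on `S`) of mass `κ(S) ≥ γ`, and on `S` the interaction exceeds the level by at most `i₀` (`J ≤ m + i₀` — a RELATIVE
excess on a window of the consumer's choosing), then `γ·e^{−(m+i₀)} ≤ ∫ G·e^{−J} dκ`. [folklore] -/
theorem hden_of_window (G J : K → ℝ) (S : Set K) {m i₀ γ : ℝ} (hG0 : ∀ x, 0 ≤ G x) (hGS : ∀ x ∈ S, 1 ≤ G x)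
    (hS : MeasurableSet S) (hγ : γ ≤ κ.real S) (hJ : ∀ x ∈ S, J x ≤ m + i₀)
    (hGJ : Integrable (fun x => G x * exp (-J x)) κ) :
    γ * exp (-(m + i₀)) ≤ ∫ x, G x * exp (-J x) ∂κ := by
  calc γ * exp (-(m + i₀)) ≤ κ.real S * exp (-(m + i₀)) := mul_le_mul_of_nonneg_right hγ (exp_pos _).le
    _ = ∫ x, S.indicator (fun _ => exp (-(m + i₀))) x ∂κ := by rw [integral_indicator_const _ hS, smul_eq_mul]
    _ ≤ ∫ x, G x * exp (-J x) ∂κ := by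
        refine integral_mono_of_nonneg (ae_of_all κ fun x => Set.indicator_nonneg (fun _ _ => (exp_pos _).le) _) hGJ
          (ae_of_all κ fun x => ?_)
        show S.indicator (fun _ => exp (-(m + i₀))) x ≤ G x * exp (-J x)
        by_cases hx : x ∈ S
        · rw [Set.indicator_of_mem hx]
          calc exp (-(m + i₀)) = 1 * exp (-(m + i₀)) := (one_mul _).symm
            _ ≤ G x * exp (-J x) :=
                mul_le_mul (hGS x hx) (exp_le_exp.mpr (neg_le_neg (hJ x hx))) (exp_pos _).le (hG0 x)
        · rw [Set.indicator_of_notMem hx]; exact mul_nonneg (hG0 x) (exp_pos _).le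

omit [SFinite κ] in
/-- **THE MASS LETTER FROM A PROFILE** (one fibre; the shape of [Balaban1989LargeFieldII] (1.2), where the excess over the minimum is a
positive quadratic form that is INTEGRATED — «`log σ₀`» per degree of freedom — rather than bounded on a ball).  If `1 ≤ G` on a
measurable `S` and on `S` the interaction exceeds the level by at most a PROFILE `q` (`J ≤ m + q`), then
`(∫_S e^{−q} dκ)·e^{−m} ≤ ∫ G·e^{−J} dκ`; `hden_of_window` is the constant profile `q ≡ i₀`. [folklore] -/
theorem hden_of_profile (G J q : K → ℝ) (S : Set K) {m : ℝ} (hG0 : ∀ x, 0 ≤ G x) (hGS : ∀ x ∈ S, 1 ≤ G x)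
    (hS : MeasurableSet S) (hJ : ∀ x ∈ S, J x ≤ m + q x) (hGJ : Integrable (fun x => G x * exp (-J x)) κ) :
    (∫ x in S, exp (-q x) ∂κ) * exp (-m) ≤ ∫ x, G x * exp (-J x) ∂κ := by
  rw [← integral_mul_const, ← integral_indicator hS]
  refine integral_mono_of_nonneg
    (ae_of_all κ fun x => Set.indicator_nonneg (fun _ _ => mul_nonneg (exp_pos _).le (exp_pos _).le) _) hGJ
    (ae_of_all κ fun x => ?_)
  show S.indicator (fun x => exp (-q x) * exp (-m)) x ≤ G x * exp (-J x)
  by_cases hx : x ∈ S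
  · rw [Set.indicator_of_mem hx, ← exp_add]
    calc exp (-q x + -m) = 1 * exp (-q x + -m) := (one_mul _).symm
      _ ≤ G x * exp (-J x) :=
          mul_le_mul (hGS x hx) (exp_le_exp.mpr (by linarith [hJ x hx])) (exp_pos _).le (hG0 x)
  · rw [Set.indicator_of_notMem hx]; exact mul_nonneg (hG0 x) (exp_pos _).le

omit [SFinite κ] [SFinite μ] in
/-- The relative conditional moment is non-negative for non-negative data (Lean's `x ∕ 0 = 0`). [folklore] -/
theorem relCarrier_nonneg (F G : K → ℝ) (w : Y → ℝ) (I : K × Y → ℝ)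
    (hF0 : ∀ x, 0 ≤ F x) (hG0 : ∀ x, 0 ≤ G x) (hw0 : ∀ y, 0 ≤ w y) :
    0 ≤ (∫ z, F z.1 * w z.2 * exp (-I z) ∂(κ.prod μ)) / ∫ z, G z.1 * w z.2 * exp (-I z) ∂(κ.prod μ) :=
  div_nonneg (integral_nonneg fun _ => mul_nonneg (mul_nonneg (hF0 _) (hw0 _)) (exp_pos _).le)
    (integral_nonneg fun _ => mul_nonneg (mul_nonneg (hG0 _) (hw0 _)) (exp_pos _).le)

/-- **CARRIER FORM.**  Under the hypotheses of `relFibre_moment_le` and the volume letter `∫F dκ ∕ γ ≤ e^{b_vol}`, the conditional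
moment `(∫F·w·e^{−I}) ∕ (∫G·w·e^{−I})` of ONE background is at most `e^{i₀ + b_vol}` (the `hMb` input of the road's
`…CarrierOnSupport.locCondStability_of_carrier_le_on_support`). [folklore] -/
theorem relCarrier_le (F G : K → ℝ) (w : Y → ℝ) (I : K × Y → ℝ) (m : Y → ℝ) {i₀ γ bvol : ℝ}
    (hF0 : ∀ x, 0 ≤ F x) (hG0 : ∀ x, 0 ≤ G x) (hw0 : ∀ y, 0 ≤ w y) (hγ : 0 < γ)
    (hnum : ∀ x y, F x ≠ 0 → w y ≠ 0 → m y ≤ I (x, y))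
    (hden : ∀ y, w y ≠ 0 → γ * exp (-(m y + i₀)) ≤ ∫ x, G x * exp (-I (x, y)) ∂κ)
    (hfrac : (∫ x, F x ∂κ) / γ ≤ exp bvol) (hF : Integrable F κ)
    (hA' : Integrable (fun z : K × Y => F z.1 * w z.2 * exp (-I z)) (κ.prod μ))
    (hB' : Integrable (fun z : K × Y => G z.1 * w z.2 * exp (-I z)) (κ.prod μ)) :
    (∫ z, F z.1 * w z.2 * exp (-I z) ∂(κ.prod μ)) / (∫ z, G z.1 * w z.2 * exp (-I z) ∂(κ.prod μ)) ≤ exp (i₀ + bvol) := by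
  have hD : 0 ≤ ∫ z, G z.1 * w z.2 * exp (-I z) ∂(κ.prod μ) :=
    integral_nonneg fun _ => mul_nonneg (mul_nonneg (hG0 _) (hw0 _)) (exp_pos _).le
  refine div_le_of_le_mul₀ hD (exp_pos _).le ?_
  calc ∫ z, F z.1 * w z.2 * exp (-I z) ∂(κ.prod μ)
      ≤ (exp i₀ * ((∫ x, F x ∂κ) / γ)) * ∫ z, G z.1 * w z.2 * exp (-I z) ∂(κ.prod μ) :=
        relFibre_moment_le κ μ F G w I m hF0 hw0 hγ hnum hden hF hA' hB'
    _ ≤ (exp i₀ * exp bvol) * ∫ z, G z.1 * w z.2 * exp (-I z) ∂(κ.prod μ) :=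
        mul_le_mul_of_nonneg_right (mul_le_mul_of_nonneg_left hfrac (exp_pos _).le) hD
    _ = exp (i₀ + bvol) * ∫ z, G z.1 * w z.2 * exp (-I z) ∂(κ.prod μ) := by rw [exp_add]

omit [SFinite κ] [SFinite μ] in
/-- **THE VOLUME LETTER FOR A SUB-UNIT NUMERATOR MASS**: `∫F dκ ≤ 1` (e.g. `F ≤ 1` on a probability fibre) and `γ > 0` give
`∫F dκ ∕ γ ≤ e^{−log γ}` — with `γ = κ(W)` a product window on a Haar probability fibre, `−log γ = Σ_bonds(−log κ_b(W_b))`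
(`…CompactFibreCarrier.neg_log_prod`), the per-degree-of-freedom price. [folklore] -/
theorem hfrac_of_subunit {A γ : ℝ} (hA : A ≤ 1) (hγ : 0 < γ) : A / γ ≤ exp (-Real.log γ) := by
  rw [exp_neg, exp_log hγ, div_eq_mul_inv]
  exact mul_le_of_le_one_left (inv_pos.mpr hγ).le hA

end Relative

/-! ## §2 A GROUP fibre with a LEFT-INVARIANT reference measure: the centred window `U₀(y)·W` has mass `κ(W)` whatever the centre -/

section Centred

variable {K Y : Type*} [MeasurableSpace K] [MeasurableSpace Y] (κ : Measure K) (μ : Measure Y)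
variable [Group K] [MeasurableMul K] [κ.IsMulLeftInvariant]

/-- **LEFT INVARIANCE: THE CENTRED WINDOW HAS THE MASS OF THE WINDOW.**  For a left-invariant `κ` (Haar) and any centre `x₀`, the
window `x₀·W = {x | x₀⁻¹x ∈ W}` has `κ`-mass `κ(W)` — so the mass letter's `γ = κ(W)` is UNIFORM in the far field `y` through the
centre `U₀(y)`. [folklore] -/
theorem real_centredWindow (x₀ : K) (W : Set K) : κ.real ((fun x => x₀⁻¹ * x) ⁻¹' W) = κ.real W := by
  rw [measureReal_def, measureReal_def, measure_preimage_mul]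

omit [κ.IsMulLeftInvariant] in
/-- The centred window is measurable when the window is. -/
theorem measurableSet_centredWindow (x₀ : K) {W : Set K} (hW : MeasurableSet W) :
    MeasurableSet ((fun x => x₀⁻¹ * x) ⁻¹' W) :=
  measurable_const_mul _ hW

/-- **LEFT INVARIANCE TRANSPORTS A PROFILE TO ANY CENTRE**: `∫_{x₀·W} f(x₀⁻¹x) dκ = ∫_W f dκ` — the mass letter of a profile around a
moving centre is the profile's integral over the FIXED window. [folklore] -/
theorem setIntegral_centredWindow (x₀ : K) {W : Set K} (hW : MeasurableSet W) (f : K → ℝ) :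
    ∫ x in (fun x => x₀⁻¹ * x) ⁻¹' W, f (x₀⁻¹ * x) ∂κ = ∫ v in W, f v ∂κ := by
  rw [← integral_indicator (measurableSet_centredWindow x₀ hW), ← integral_indicator hW,
    ← integral_mul_left_eq_self (W.indicator f) x₀⁻¹]
  -- the two integrands `(x₀⁻¹·)⁻¹'W).indicator (f ∘ (x₀⁻¹·))` and `W.indicator f ∘ (x₀⁻¹·)` agree definitionally
  -- (`Set.indicator_comp_right`)
  congr 1

variable [SFinite κ] [SFinite μ]

/-- **THE FIBREWISE-RELATIVE COMPACT SANDWICH ON A GROUP FIBRE, CENTRED WINDOWS.**  Near fibre a measurable group `K` with a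
left-invariant s-finite measure `κ` (Haar on the pinned region's bond variables), far space `(Y, μ)`; numerator factor `F ≥ 0`
integrable, denominator factor `G ≥ 0`, far weight `w ≥ 0`, interaction `I`, fibrewise level `m(y)` with `m y ≤ I (x, y)` on the
numerator's support (`hnum`); a fibrewise CENTRE `U₀ : Y → K` and ONE measurable window `W ⊆ K` of positive mass such that, wherever
`w y ≠ 0`, the denominator factor dominates the centred window (`hGwin : 1 ≤ G (U₀ y · v)` for `v ∈ W` — the denominator's small-field
window CONTAINS the `W`-neighbourhood of the centre) and the interaction's RELATIVE excess there is at most `i₀`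
(`hIrel : I (U₀ y · v, y) ≤ m y + i₀` for `v ∈ W` — for the fibre minimiser and a window of radius `∼ g_k`, second order in the radius);
integrabilities displayed.  Then `∫ F·w·e^{−I} d(κ⊗μ) ≤ e^{i₀}·(∫F dκ ∕ κ(W))·∫ G·w·e^{−I} d(κ⊗μ)` — the interface level `m(y)` has
cancelled; the price is `i₀` plus the LOG OF THE VOLUME RATIO `∫F dκ ∕ κ(W)`. [folklore] -/
theorem relFibre_moment_le_of_centredWindow (F G : K → ℝ) (w : Y → ℝ) (I : K × Y → ℝ) (m : Y → ℝ) (U₀ : Y → K)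
    (W : Set K) {i₀ : ℝ} (hF0 : ∀ x, 0 ≤ F x) (hG0 : ∀ x, 0 ≤ G x) (hw0 : ∀ y, 0 ≤ w y)
    (hW : MeasurableSet W) (hWpos : 0 < κ.real W)
    (hnum : ∀ x y, F x ≠ 0 → w y ≠ 0 → m y ≤ I (x, y))
    (hGwin : ∀ y v, w y ≠ 0 → v ∈ W → 1 ≤ G (U₀ y * v))
    (hIrel : ∀ y v, w y ≠ 0 → v ∈ W → I (U₀ y * v, y) ≤ m y + i₀)
    (hF : Integrable F κ) (hGI : ∀ y, w y ≠ 0 → Integrable (fun x => G x * exp (-I (x, y))) κ)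
    (hA' : Integrable (fun z : K × Y => F z.1 * w z.2 * exp (-I z)) (κ.prod μ))
    (hB' : Integrable (fun z : K × Y => G z.1 * w z.2 * exp (-I z)) (κ.prod μ)) :
    ∫ z, F z.1 * w z.2 * exp (-I z) ∂(κ.prod μ) ≤
      (exp i₀ * ((∫ x, F x ∂κ) / κ.real W)) * ∫ z, G z.1 * w z.2 * exp (-I z) ∂(κ.prod μ) := by
  refine relFibre_moment_le κ μ F G w I m hF0 hw0 hWpos hnum (fun y hy => ?_) hF hA' hB'
  refine hden_of_window κ G (fun x => I (x, y)) ((fun x => (U₀ y)⁻¹ * x) ⁻¹' W) hG0 (fun x hx => ?_)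
    (measurableSet_centredWindow (U₀ y) hW) (real_centredWindow κ (U₀ y) W).ge (fun x hx => ?_) (hGI y hy)
  · have h := hGwin y ((U₀ y)⁻¹ * x) hy hx
    rwa [mul_inv_cancel_left] at h
  · have h := hIrel y ((U₀ y)⁻¹ * x) hy hx
    rwa [mul_inv_cancel_left] at h

/-- **THE SAME WITH A PROFILE INSTEAD OF A CONSTANT EXCESS** (print's (1.2) shape on a group fibre): if on the centred window the
interaction exceeds the level by at most a PROFILE of the relative position, `hIprof : I (U₀ y · v, y) ≤ m y + q v` for `v ∈ W`, and
`∫_W e^{−q} dκ > 0`, then `∫ F·w·e^{−I} d(κ⊗μ) ≤ (∫F dκ ∕ ∫_W e^{−q} dκ)·∫ G·w·e^{−I} d(κ⊗μ)` — NO sup at all: the excess is integrated,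
and by left invariance (`setIntegral_centredWindow`) its integral does not see the centre. [folklore] -/
theorem relFibre_moment_le_of_centredProfile (F G : K → ℝ) (w : Y → ℝ) (I : K × Y → ℝ) (m : Y → ℝ) (U₀ : Y → K)
    (W : Set K) (q : K → ℝ) (hF0 : ∀ x, 0 ≤ F x) (hG0 : ∀ x, 0 ≤ G x) (hw0 : ∀ y, 0 ≤ w y)
    (hW : MeasurableSet W) (hqpos : 0 < ∫ v in W, exp (-q v) ∂κ)
    (hnum : ∀ x y, F x ≠ 0 → w y ≠ 0 → m y ≤ I (x, y))
    (hGwin : ∀ y v, w y ≠ 0 → v ∈ W → 1 ≤ G (U₀ y * v))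
    (hIprof : ∀ y v, w y ≠ 0 → v ∈ W → I (U₀ y * v, y) ≤ m y + q v)
    (hF : Integrable F κ) (hGI : ∀ y, w y ≠ 0 → Integrable (fun x => G x * exp (-I (x, y))) κ)
    (hA' : Integrable (fun z : K × Y => F z.1 * w z.2 * exp (-I z)) (κ.prod μ))
    (hB' : Integrable (fun z : K × Y => G z.1 * w z.2 * exp (-I z)) (κ.prod μ)) :
    ∫ z, F z.1 * w z.2 * exp (-I z) ∂(κ.prod μ) ≤
      ((∫ x, F x ∂κ) / ∫ v in W, exp (-q v) ∂κ) * ∫ z, G z.1 * w z.2 * exp (-I z) ∂(κ.prod μ) := by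
  have hden : ∀ y, w y ≠ 0 →
      (∫ v in W, exp (-q v) ∂κ) * exp (-(m y + 0)) ≤ ∫ x, G x * exp (-I (x, y)) ∂κ := by
    intro y hy
    rw [add_zero, ← setIntegral_centredWindow κ (U₀ y) hW (fun v => exp (-q v))]
    refine hden_of_profile κ G (fun x => I (x, y)) (fun x => q ((U₀ y)⁻¹ * x)) _ hG0 (fun x hx => ?_)
      (measurableSet_centredWindow (U₀ y) hW) (fun x hx => ?_) (hGI y hy)
    · have h := hGwin y ((U₀ y)⁻¹ * x) hy hx
      rwa [mul_inv_cancel_left] at h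
    · have h := hIprof y ((U₀ y)⁻¹ * x) hy hx
      rwa [mul_inv_cancel_left] at h
  have key := relFibre_moment_le κ μ F G w I m hF0 hw0 hqpos hnum hden hF hA' hB'
  rwa [exp_zero, one_mul] at key

/-- **CARRIER FORM, CENTRED WINDOWS**: with the volume letter `∫F dκ ∕ κ(W) ≤ e^{b_vol}` the conditional moment of ONE background is at
most `e^{i₀ + b_vol}` (input `hMb` of `…CarrierOnSupport.locCondStability_of_carrier_le_on_support`; `relCarrier_nonneg` is `hM0`).
[folklore] -/
theorem relCarrier_le_of_centredWindow (F G : K → ℝ) (w : Y → ℝ) (I : K × Y → ℝ) (m : Y → ℝ) (U₀ : Y → K)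
    (W : Set K) {i₀ bvol : ℝ} (hF0 : ∀ x, 0 ≤ F x) (hG0 : ∀ x, 0 ≤ G x) (hw0 : ∀ y, 0 ≤ w y)
    (hW : MeasurableSet W) (hWpos : 0 < κ.real W)
    (hnum : ∀ x y, F x ≠ 0 → w y ≠ 0 → m y ≤ I (x, y))
    (hGwin : ∀ y v, w y ≠ 0 → v ∈ W → 1 ≤ G (U₀ y * v))
    (hIrel : ∀ y v, w y ≠ 0 → v ∈ W → I (U₀ y * v, y) ≤ m y + i₀)
    (hfrac : (∫ x, F x ∂κ) / κ.real W ≤ exp bvol)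
    (hF : Integrable F κ) (hGI : ∀ y, w y ≠ 0 → Integrable (fun x => G x * exp (-I (x, y))) κ)
    (hA' : Integrable (fun z : K × Y => F z.1 * w z.2 * exp (-I z)) (κ.prod μ))
    (hB' : Integrable (fun z : K × Y => G z.1 * w z.2 * exp (-I z)) (κ.prod μ)) :
    (∫ z, F z.1 * w z.2 * exp (-I z) ∂(κ.prod μ)) / (∫ z, G z.1 * w z.2 * exp (-I z) ∂(κ.prod μ)) ≤ exp (i₀ + bvol) := by
  have hD : 0 ≤ ∫ z, G z.1 * w z.2 * exp (-I z) ∂(κ.prod μ) :=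
    integral_nonneg fun _ => mul_nonneg (mul_nonneg (hG0 _) (hw0 _)) (exp_pos _).le
  refine div_le_of_le_mul₀ hD (exp_pos _).le ?_
  calc ∫ z, F z.1 * w z.2 * exp (-I z) ∂(κ.prod μ)
      ≤ (exp i₀ * ((∫ x, F x ∂κ) / κ.real W)) * ∫ z, G z.1 * w z.2 * exp (-I z) ∂(κ.prod μ) :=
        relFibre_moment_le_of_centredWindow κ μ F G w I m U₀ W hF0 hG0 hw0 hW hWpos hnum hGwin hIrel hF hGI hA' hB'
    _ ≤ (exp i₀ * exp bvol) * ∫ z, G z.1 * w z.2 * exp (-I z) ∂(κ.prod μ) :=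
        mul_le_mul_of_nonneg_right (mul_le_mul_of_nonneg_left hfrac (exp_pos _).le) hD
    _ = exp (i₀ + bvol) * ∫ z, G z.1 * w z.2 * exp (-I z) ∂(κ.prod μ) := by rw [exp_add]

end Centred

end Summit.QuantumFields.BalabanUV.T4Continuum.NE7b.CompactFibreRelative
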